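import Summits.QuantumFields.BalabanUV.Beta.GAN24.TransverseProjector

/-!
# Beta / AliasBlock — the rank-one-deflated scalar block `N = L·1 − ∂ ⊗ ∂♭` of ONE alias mode, as MATRIX algebra:
# `N ∂ = 0`, `∂♭ᵀ N = 0`, `N² = L·N`, its group ({1,2}-) inverse `N/L²`, `N · (N/L²) = 1 − (∂/L) ⊗ ∂♭`, and the link
# `N v = L · Π⊥ v` to the transverse projector of `GAN24/TransverseProjector`
# (β sub-cell, CAP lane «KERNEL ALGEBRA + EXPORT», lineage `b2b-balaban-beta-cap3`, gen 10; instance facts I2 for `Beta/SaddleInverse` + `Beta/ModeSum`)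

WHY.  The abstract kernel-pairing theorems of `Beta/SaddleInverse` (`saddle_mul_pairingInv`, …) take hypotheses `A N = 0`,
`A G = 1 − Y L` (and the FP products); `Beta/ModeSum` (`Biorth.groupInverse`, `Biorth.one_sub_modeSum_mul`) reduces them, for a
mode-diagonal `A = Σ_t E_t X_t F_t`, to PER-MODE facts about the `D × D` blocks `X_t`.  In the cell's instance (CAP-KERNEL §4.15–§4.17) the
per-mode block of the gauge-NON-fixed quadratic form at one alias momentum is `N_t = Δ_t·1 − ∂_t ∂♭_tᵀ` with `∂♭_t·∂_t = Δ_t` — the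
Laplacian symbol times the transverse projector.  This leaf records, once, as [folklore] matrix algebra over any commutative ring, the
identities an instance file then invokes BY NAME: the kernel directions (`nMat_mulVec_dd`, `db_vecMul_nMat`, hence `A N = 0` and `L A = 0`
blockwise), idempotency up to `L` (`nMat_mul_nMat`), the {1,2}-inverse `c²·N` for `c L = 1` (`nMat_groupInverse₁`, `nMat_groupInverse₂`),
the projector identity `N · (c²N) = 1 − (c·∂) ⊗ ∂♭` (`nMat_mul_pinv` — the shape `A G = 1 − Y L` with `Y = c·∂` a column and `L = ∂♭ᵀ` a row,
cf. `Matrix.vecMulVec_eq`), and the dictionary to road P1-fibre's `TransverseProjector.projT` over `ℂ` (`nMat_mulVec_eq_smul_projT`).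

## What is proved (index type `ι` finite with decidable equality; `R` a commutative ring; hypothesis `h : db ⬝ᵥ dd = L` where stated)
* §1 `nMat dd db L := L • 1 − vecMulVec dd db`; `nMat_apply`; `nMat_mulVec` (`N v = L•v − (db ⬝ᵥ v)•dd`), `vecMul_nMat`;
  `nMat_mulVec_dd : N *ᵥ dd = 0`, `db_vecMul_nMat : db ᵥ* N = 0`; `nMat_mul_vecMulVec_dd`, `vecMulVec_db_mul_nMat` (matrix forms).
* §2 `nMat_mul_nMat : N * N = L • N`; `nMat_mul_nMat_mul_nMat : N * N * N = L² • N`; for `c * L = 1`: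
  `nMat_groupInverse₁ : N * (c² • N) * N = N`, `nMat_groupInverse₂ : (c² • N) * N * (c² • N) = c² • N`,
  `nMat_mul_pinv : N * (c² • N) = 1 − vecMulVec (c • dd) db`, `pinv_mul_nMat` (same on the left), and the complementary projector
  `one_sub_vecMulVec_mulVec_dd` (`(1 − (c∂) ⊗ ∂♭) ∂ = 0`), `db_vecMul_one_sub_vecMulVec` (`∂♭ᵀ (1 − (c∂) ⊗ ∂♭) = 0`).
* §3 (`R = ℂ`, `ι = Fin D`) `dot_eq_dotProduct : FibreBlockSolve.dot u v = u ⬝ᵥ v` and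
  `nMat_mulVec_eq_smul_projT : L ≠ 0 → nMat dd db L *ᵥ v = L • projT dd db L v`.

HONEST FRAMING.  Finite-dimensional matrix identities, [folklore]; no estimate, no cited fact, no number.  This module proves NO bound on any
object of the cell, NO number of the β-function, NO statement about Bałaban's operators and discharges NOTHING of `FlowStep.BetaPertH`; it
is not an engine and not an instance file for the concrete `408 × 408` matrices.  Discharging `BetaPertH` would make Bałaban's ultraviolet
stability unconditional — NOT the continuum limit and NOT the Clay problem.  0 `sorry`, 0 cite tags; imports `Beta/GAN24/TransverseProjector` only.
-/

namespace Summit.QuantumFields.BalabanUV.Beta.AliasBlock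

open Matrix

section CommRing

variable {ι R : Type*} [Fintype ι] [DecidableEq ι] [CommRing R]

/-! ## §1 The block and its kernel directions -/

omit [Fintype ι] in
/-- The alias block `N = L·1 − ∂ ⊗ ∂♭` (entries `L·δ_{κl} − ∂_κ ∂♭_l`). -/
def nMat (dd db : ι → R) (L : R) : Matrix ι ι R := L • (1 : Matrix ι ι R) - vecMulVec dd db

omit [Fintype ι] in
/-- [folklore] Entries of the alias block. -/
theorem nMat_apply (dd db : ι → R) (L : R) (κ l : ι) :
    nMat dd db L κ l = (if κ = l then L else 0) - dd κ * db l := by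
  simp [nMat, vecMulVec_apply, Matrix.one_apply]

/-- `N v = L•v − (∂♭·v)•∂`. -/
theorem nMat_mulVec (dd db : ι → R) (L : R) (v : ι → R) :
    nMat dd db L *ᵥ v = L • v - (db ⬝ᵥ v) • dd := by
  simp [nMat, sub_mulVec, smul_mulVec, one_mulVec, vecMulVec_mulVec]

/-- `u N = L•u − (u·∂)•∂♭`. -/
theorem vecMul_nMat (dd db : ι → R) (L : R) (u : ι → R) :
    u ᵥ* nMat dd db L = L • u - (u ⬝ᵥ dd) • db := by
  simp [nMat, vecMul_sub, vecMul_smul, vecMul_one, vecMul_vecMulVec]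

variable {dd db : ι → R} {L : R}

/-- The pure-gauge direction is killed: `N ∂ = 0`. -/
theorem nMat_mulVec_dd (h : db ⬝ᵥ dd = L) : nMat dd db L *ᵥ dd = 0 := by
  rw [nMat_mulVec, h, sub_self]

/-- The range is transverse: `∂♭ᵀ N = 0`. -/
theorem db_vecMul_nMat (h : db ⬝ᵥ dd = L) : db ᵥ* nMat dd db L = 0 := by
  rw [vecMul_nMat, h, sub_self]

/-- Matrix form of `N ∂ = 0`: `N · (∂ ⊗ x) = 0` for every row vector `x`. -/
theorem nMat_mul_vecMulVec_dd (h : db ⬝ᵥ dd = L) {κ' : Type*} (x : κ' → R) :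
    nMat dd db L * vecMulVec dd x = 0 := by
  rw [mul_vecMulVec, nMat_mulVec_dd h]; ext; simp [vecMulVec_apply]

/-- Matrix form of `∂♭ᵀ N = 0`: `(x ⊗ ∂♭) · N = 0` for every column vector `x`. -/
theorem vecMulVec_db_mul_nMat (h : db ⬝ᵥ dd = L) {κ' : Type*} (x : κ' → R) :
    vecMulVec x db * nMat dd db L = 0 := by
  rw [vecMulVec_mul, db_vecMul_nMat h]; ext; simp [vecMulVec_apply]

/-! ## §2 Idempotency up to `L` and the group inverse -/

/-- `N² = L·N`. -/
theorem nMat_mul_nMat (h : db ⬝ᵥ dd = L) : nMat dd db L * nMat dd db L = L • nMat dd db L :=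
  calc nMat dd db L * nMat dd db L
        = nMat dd db L * (L • (1 : Matrix ι ι R)) - nMat dd db L * vecMulVec dd db := by rw [← mul_sub]; rfl
    _ = L • nMat dd db L := by rw [nMat_mul_vecMulVec_dd h, sub_zero, Matrix.mul_smul, mul_one]

/-- `N³ = L²·N`. -/
theorem nMat_mul_nMat_mul_nMat (h : db ⬝ᵥ dd = L) :
    nMat dd db L * nMat dd db L * nMat dd db L = (L ^ 2) • nMat dd db L := by
  rw [nMat_mul_nMat h, Matrix.smul_mul, nMat_mul_nMat h, smul_smul, sq]

/-- {1}-inverse: with `c L = 1`, `N (c² N) N = N`. -/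
theorem nMat_groupInverse₁ (h : db ⬝ᵥ dd = L) {c : R} (hc : c * L = 1) :
    nMat dd db L * ((c ^ 2) • nMat dd db L) * nMat dd db L = nMat dd db L := by
  rw [Matrix.mul_smul, Matrix.smul_mul, nMat_mul_nMat_mul_nMat h, smul_smul,
    show c ^ 2 * L ^ 2 = (c * L) ^ 2 by ring, hc, one_pow, one_smul]

/-- {2}-inverse: with `c L = 1`, `(c² N) N (c² N) = c² N`. -/
theorem nMat_groupInverse₂ (h : db ⬝ᵥ dd = L) {c : R} (hc : c * L = 1) :
    ((c ^ 2) • nMat dd db L) * nMat dd db L * ((c ^ 2) • nMat dd db L) = (c ^ 2) • nMat dd db L := by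
  rw [Matrix.smul_mul, Matrix.smul_mul, Matrix.mul_smul, nMat_mul_nMat_mul_nMat h, smul_smul, smul_smul]
  congr 1
  rw [show c ^ 2 * c ^ 2 * L ^ 2 = c ^ 2 * (c * L) ^ 2 by ring, hc, one_pow, mul_one]

/-- The projector identity `N · (c² N) = 1 − (c ∂) ⊗ ∂♭` (`c L = 1`): the shape `A G = 1 − Y L` of `Beta/SaddleInverse` with the column
`Y = c ∂` and the row `L = ∂♭ᵀ`. -/
theorem nMat_mul_pinv (h : db ⬝ᵥ dd = L) {c : R} (hc : c * L = 1) :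
    nMat dd db L * ((c ^ 2) • nMat dd db L) = 1 - vecMulVec (c • dd) db := by
  rw [Matrix.mul_smul, nMat_mul_nMat h, smul_smul, show c ^ 2 * L = c * (c * L) by ring, hc, mul_one,
    show nMat dd db L = L • (1 : Matrix ι ι R) - vecMulVec dd db from rfl, smul_sub, smul_smul, hc, one_smul,
    smul_vecMulVec]

/-- The same on the left: `(c² N) · N = 1 − (c ∂) ⊗ ∂♭`. -/
theorem pinv_mul_nMat (h : db ⬝ᵥ dd = L) {c : R} (hc : c * L = 1) :
    ((c ^ 2) • nMat dd db L) * nMat dd db L = 1 - vecMulVec (c • dd) db := by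
  rw [Matrix.smul_mul, ← Matrix.mul_smul, nMat_mul_pinv h hc]

/-- `(1 − (c ∂) ⊗ ∂♭) ∂ = 0` when `c L = 1`: the complementary projector kills `∂`. -/
theorem one_sub_vecMulVec_mulVec_dd (h : db ⬝ᵥ dd = L) {c : R} (hc : c * L = 1) :
    (1 - vecMulVec (c • dd) db) *ᵥ dd = 0 := by
  rw [sub_mulVec, one_mulVec, vecMulVec_mulVec, h]
  ext κ
  simp [Pi.smul_apply, smul_eq_mul, show L * (c * dd κ) = (c * L) * dd κ by ring, hc]

/-- `∂♭ᵀ (1 − (c ∂) ⊗ ∂♭) = 0` when `c L = 1`. -/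
theorem db_vecMul_one_sub_vecMulVec (h : db ⬝ᵥ dd = L) {c : R} (hc : c * L = 1) :
    db ᵥ* (1 - vecMulVec (c • dd) db) = 0 := by
  rw [vecMul_sub, vecMul_one, vecMul_vecMulVec, dotProduct_smul, h]
  ext κ
  simp [smul_eq_mul, hc]

end CommRing

/-! ## §3 Dictionary to `GAN24/TransverseProjector.projT` over `ℂ` -/

section Complex

open GAN24.FibreBlockSolve (dot)
open GAN24.TransverseProjector (projT projT_apply)

variable {D : ℕ}

/-- [folklore] `FibreBlockSolve.dot` is Mathlib's `dotProduct` (by `rfl`). -/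
theorem dot_eq_dotProduct (u v : Fin D → ℂ) : dot u v = u ⬝ᵥ v := rfl

/-- `N v = L · Π⊥ v` (`L ≠ 0`): the alias block is the Laplacian symbol times road P1-fibre's transverse projector. -/
theorem nMat_mulVec_eq_smul_projT (dd db : Fin D → ℂ) {L : ℂ} (hL : L ≠ 0) (v : Fin D → ℂ) :
    nMat dd db L *ᵥ v = L • projT dd db L v := by
  rw [nMat_mulVec]
  ext κ
  simp only [Pi.sub_apply, Pi.smul_apply, smul_eq_mul, projT_apply, ← dot_eq_dotProduct]
  rw [mul_sub]
  congr 1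
  field_simp

end Complex

end Summit.QuantumFields.BalabanUV.Beta.AliasBlock
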